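/-
Copyright: internal research formalization. Source texts: W. Fulton, Introduction to Toric Varieties
(Princeton UP 1993) [Fulton1993Toric], §2.1 p. 29 (nonsingular cones) and §2.6 p. 48
(multiplicity of a simplicial cone, the lattice point `Σ tᵢvᵢ, 0 ≤ tᵢ < 1`, and its use in a
star subdivision); G. Ewald, Combinatorial Convexity and Algebraic Geometry (GTM 168, 1996)
[Ewald1996], V §1 (lattice cones, regular cones) and VI Thm. 8.5 (proof).
-/
import Mathlib
import HarnessLib
import Literature.Geometry.PolyhedralFans.StarSubdivision

/-!
# Lattice points in the fundamental parallelotope of a simplicial lattice cone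

Topic: `Literature/Geometry/PolyhedralFans`; the lattice layer of the regular-refinement theorem
([KempfEtAl1973] Ch. I Thm. 11; [Fulton1993Toric] §2.6 Prop. p. 48; [Ewald1996] VI Thm. 8.5).
Ambient space `κ → ℚ`, lattice `N = ℤ^κ` (`latticeN κ`).

## Content (all PROVED; no named facts)

* `latticeN κ` — the lattice `ℤ^κ ⊆ ℚ^κ` as a `ℤ`-submodule; `IsPrimitive x` — `x` is the
  first lattice point on its ray ([Fulton1993Toric] §2.6 p. 48 "the first lattice points along
  the edges"); uniqueness on a ray (`IsPrimitive.eq_of_eq_smul`) and existence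
  (`exists_isPrimitive_smul`);
* `parCoeffs S` — for a finite set `S` of vectors, the coefficient vectors `a ∈ [0,1)^S` whose
  combination `Σ a_s s` is a lattice point (the lattice points of the half-open fundamental
  parallelotope, [Fulton1993Toric] §2.6 p. 48 Exercise "a lattice point of the form
  `v = Σ tᵢvᵢ, 0 ≤ tᵢ < 1`"), `parCoeffs_finite`, and the count
  `pmult S = #parCoeffs S` (for a simplicial lattice cone this is the index
  `[N_σ : ℤv₁ + … + ℤv_k]` = Fulton's multiplicity `mult(σ)`; we do not need and do not prove
  that identification — `pmult` is used only as a termination measure);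
* `IsRegularGens S` — `S` consists of linearly independent lattice vectors whose `ℤ`-span is
  saturated in `N` (= `S` is part of a `ℤ`-basis of `N`, [Fulton1993Toric] §2.1 p. 29
  "generated by part of a basis for the lattice"; the basis-extension form is not needed here);
  `isRegularGens_iff_parCoeffs` — **regular ⇔ the only parallelotope lattice point is `0`**
  ([Fulton1993Toric] §2.6 p. 48: "`U_σ` is nonsingular precisely when the multiplicity of `σ` is
  one", in the parallelotope form), hence `exists_ne_zero_of_not_isRegularGens`;
* `pmult_exchange_lt` — **the count drops under the exchange `S ↦ (S ∖ {v_j}) ∪ {w}`**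
  for a parallelotope lattice point `w = Σ a_s s` with `a_j ≠ 0` ([Fulton1993Toric] §2.6 p. 48
  Exercise: "the multiplicities of the subdivided cones are `tᵢ · mult(σ)`"; we prove the strict
  inequality by the explicit injection "reduce coefficients mod 1", which misses `a`).

## Not here

The identification `pmult = [N_σ : Σ ℤvᵢ]` and `|det|`; fans (next layer).
-/

noncomputable section

namespace Literature.Geometry.PolyhedralFans

open PointedCone Finset

variable {κ : Type*}

/-! ## The lattice `ℤ^κ ⊆ ℚ^κ` and primitive vectors -/

/-- The lattice `N = ℤ^κ` inside `ℚ^κ`, as a `ℤ`-submodule: the vectors with integer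
coordinates ([Fulton1993Toric] §1.1 p. 4, "a lattice `N ≅ ℤⁿ`" inside `N_ℝ`; here over `ℚ`).
[cite: Fulton1993Toric, §1.1 p. 4] -/
def latticeN (κ : Type*) : Submodule ℤ (κ → ℚ) where
  carrier := {x | ∀ i, ∃ m : ℤ, x i = m}
  zero_mem' := fun _ => ⟨0, by simp⟩
  add_mem' := by
    intro x y hx hy i
    obtain ⟨m, hm⟩ := hx i
    obtain ⟨m', hm'⟩ := hy i
    exact ⟨m + m', by simp [hm, hm']⟩
  smul_mem' := by
    intro c x hx i
    obtain ⟨m, hm⟩ := hx i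
    exact ⟨c * m, by simp [hm, zsmul_eq_mul]⟩

/-- Membership in the lattice: all coordinates are integers. [cite: Fulton1993Toric, §1.1 p. 4] -/
theorem mem_latticeN_iff {x : κ → ℚ} : x ∈ latticeN κ ↔ ∀ i, ∃ m : ℤ, x i = m := Iff.rfl

/-- Integer (rational-scalar) multiples of lattice vectors are lattice vectors.
[cite: Fulton1993Toric, §1.1 p. 4] -/
theorem intCast_smul_mem_latticeN {x : κ → ℚ} (hx : x ∈ latticeN κ) (m : ℤ) :
    (m : ℚ) • x ∈ latticeN κ := by
  rw [Int.cast_smul_eq_zsmul]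
  exact (latticeN κ).smul_mem m hx

/-- Integer combinations of lattice vectors are lattice vectors. [cite: Fulton1993Toric, §1.1 p. 4] -/
theorem sum_intCast_smul_mem_latticeN {S : Finset (κ → ℚ)} (hS : ∀ s ∈ S, s ∈ latticeN κ)
    (m : (κ → ℚ) → ℤ) : ∑ s ∈ S, (m s : ℚ) • s ∈ latticeN κ :=
  Submodule.sum_mem _ fun s hs => intCast_smul_mem_latticeN (hS s hs) (m s)

/-- A vector is **primitive** if it is a nonzero lattice vector and the first lattice point on its
ray: no `c • x` with `0 < c < 1` is a lattice point ([Fulton1993Toric] §2.6 p. 48, "the first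
lattice points along the edges"; [Ewald1996] V §1 "simple" vectors).
[cite: Fulton1993Toric, §2.6 p. 48] -/
def IsPrimitive (x : κ → ℚ) : Prop :=
  x ∈ latticeN κ ∧ x ≠ 0 ∧ ∀ c : ℚ, 0 < c → c • x ∈ latticeN κ → 1 ≤ c

/-- **Two primitive vectors on the same ray are equal.** [cite: Fulton1993Toric, §2.6 p. 48] -/
theorem IsPrimitive.eq_of_eq_smul {p q : κ → ℚ} (hp : IsPrimitive p) (hq : IsPrimitive q)
    {c : ℚ} (hc : 0 < c) (h : q = c • p) : p = q := by
  have h1 : 1 ≤ c := hp.2.2 c hc (h ▸ hq.1)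
  have h2 : 1 ≤ c⁻¹ := by
    refine hq.2.2 c⁻¹ (inv_pos.mpr hc) ?_
    rw [h, smul_smul, inv_mul_cancel₀ hc.ne', one_smul]
    exact hp.1
  have hc1 : c = 1 := le_antisymm (one_le_inv_iff₀.mp h2).2 h1
  rw [h, hc1, one_smul]

/-- Two primitive vectors spanning the same ray are equal. [cite: Fulton1993Toric, §2.6 p. 48] -/
theorem IsPrimitive.eq_of_ray_eq {p q : κ → ℚ} (hp : IsPrimitive p) (hq : IsPrimitive q)
    (h : ray ℚ p = ray ℚ q) : p = q := by
  have hq' : q ∈ ray ℚ p := h ▸ self_mem_ray q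
  obtain ⟨c, hc, hqc⟩ := mem_ray_iff.mp hq'
  rcases hc.lt_or_eq with hc | rfl
  · exact hp.eq_of_eq_smul hq hc hqc
  · exact absurd (by rw [hqc, zero_smul]) hq.2.1

/-- **Every nonzero lattice vector has a primitive vector on its ray**, namely `c • x` for some
`0 < c ≤ 1`. [cite: Fulton1993Toric, §2.6 p. 48] -/
theorem exists_isPrimitive_smul {x : κ → ℚ} (hx : x ∈ latticeN κ) (hx0 : x ≠ 0) :
    ∃ c : ℚ, 0 < c ∧ c ≤ 1 ∧ IsPrimitive (c • x) := by
  classical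
  obtain ⟨i₀, hi₀⟩ : ∃ i, x i ≠ 0 := by
    by_contra h
    push Not at h
    exact hx0 (funext h)
  obtain ⟨m, hm⟩ := hx i₀
  have hm0 : m ≠ 0 := by rintro rfl; rw [Int.cast_zero] at hm; exact hi₀ hm
  set M : ℕ := m.natAbs with hM
  have hMpos : 0 < M := Int.natAbs_pos.mpr hm0
  have hMq : (0 : ℚ) < M := by exact_mod_cast hMpos
  -- admissible numerators
  let P : ℕ → Prop := fun k => 0 < k ∧ ((k : ℚ) / M) • x ∈ latticeN κ
  have hPM : P M := ⟨hMpos, by rw [div_self hMq.ne', one_smul]; exact hx⟩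
  have hex : ∃ k, P k := ⟨M, hPM⟩
  set k₀ := Nat.find hex with hk₀
  have hk₀P : P k₀ := Nat.find_spec hex
  have hk₀le : k₀ ≤ M := Nat.find_min' hex hPM
  have hk₀pos : (0 : ℚ) < k₀ := by exact_mod_cast hk₀P.1
  refine ⟨(k₀ : ℚ) / M, div_pos hk₀pos hMq, (div_le_one hMq).mpr (by exact_mod_cast hk₀le),
    hk₀P.2, smul_ne_zero (div_pos hk₀pos hMq).ne' hx0, fun c hc hcmem => ?_⟩
  -- `c • (k₀/M) • x ∈ N` forces `c k₀ ∈ ℕ` and then `c k₀ ≥ k₀`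
  obtain ⟨z, hz⟩ := hcmem i₀
  simp only [Pi.smul_apply, smul_eq_mul] at hz
  rw [hm] at hz
  -- `c * (k₀ / M) * m = z`, hence `c * k₀ * |m| = |z| * |m|`... we extract `c * k₀ = |z|`
  have hMm : (M : ℚ) = |(m : ℚ)| := by
    rw [hM, Nat.cast_natAbs, Int.cast_abs]
  have hM0 : (M : ℚ) ≠ 0 := hMq.ne'
  have hck : c * k₀ = |(z : ℚ)| := by
    have h1 : c * (k₀ : ℚ) * m = z * M := by
      have h1' : c * ((k₀ : ℚ) / M * m) * M = c * k₀ * m := by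
        rw [div_mul_eq_mul_div, ← mul_div_assoc, div_mul_cancel₀ _ hM0]; ring
      rw [← h1', hz]
    have h2 : |c * (k₀ : ℚ)| * |(m : ℚ)| = |(z : ℚ)| * |(m : ℚ)| := by
      rw [← abs_mul, h1, abs_mul, ← hMm, Nat.abs_cast]
    have hmq : |(m : ℚ)| ≠ 0 := abs_ne_zero.mpr (by exact_mod_cast hm0)
    have h3 := mul_right_cancel₀ hmq h2
    rwa [abs_of_pos (mul_pos hc hk₀pos)] at h3
  have hzpos : 0 < z.natAbs := by
    have : (0 : ℚ) < |(z : ℚ)| := by rw [← hck]; exact mul_pos hc hk₀pos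
    rw [← Int.cast_abs] at this
    have h' : 0 < |z| := by exact_mod_cast this
    exact Int.natAbs_pos.mpr (abs_pos.mp h')
  have hPz : P z.natAbs := by
    refine ⟨hzpos, ?_⟩
    have : ((z.natAbs : ℚ) / M) • x = c • (((k₀ : ℚ) / M) • x) := by
      rw [smul_smul, Nat.cast_natAbs, Int.cast_abs, ← hck]
      ring_nf
    rw [this]; exact hcmem
  have hle : k₀ ≤ z.natAbs := Nat.find_min' hex hPz
  have hle' : (k₀ : ℚ) ≤ z.natAbs := by exact_mod_cast hle
  rw [Nat.cast_natAbs, Int.cast_abs, ← hck] at hle'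
  nlinarith

/-! ## Coefficient vectors and the parallelotope lattice points -/

/-- Linear independence of a finite set of vectors as uniqueness of coefficients of
combinations `Σ_{s ∈ S} a_s s`. [cite: Fulton1993Toric, §2.1 p. 29] -/
theorem eq_on_of_sum_smul_eq {S : Finset (κ → ℚ)} (hli : LinearIndepOn ℚ id (S : Set (κ → ℚ)))
    {f g : (κ → ℚ) → ℚ} (h : ∑ s ∈ S, f s • s = ∑ s ∈ S, g s • s) : ∀ s ∈ S, f s = g s :=
  (linearIndepOn_finset_iffₛ.mp hli) f g (by simpa using h)

/-- The **parallelotope coefficient vectors** of a finite set `S` of vectors: functions `a`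
vanishing off `S` with `0 ≤ a_s < 1` on `S` and `Σ a_s s` a lattice point — the lattice
points of the half-open fundamental parallelotope `{Σ tᵢvᵢ : 0 ≤ tᵢ < 1}` in coordinates
([Fulton1993Toric] §2.6 p. 48, Exercise). [cite: Fulton1993Toric, §2.6 p. 48] -/
def parCoeffs (S : Finset (κ → ℚ)) : Set ((κ → ℚ) → ℚ) :=
  {a | (∀ s ∈ S, 0 ≤ a s ∧ a s < 1) ∧ (∀ s, s ∉ S → a s = 0) ∧
    ∑ s ∈ S, a s • s ∈ latticeN κ}

/-- Membership in `parCoeffs`, unfolded. [cite: Fulton1993Toric, §2.6 p. 48] -/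
theorem mem_parCoeffs_iff {S : Finset (κ → ℚ)} {a : (κ → ℚ) → ℚ} :
    a ∈ parCoeffs S ↔ (∀ s ∈ S, 0 ≤ a s ∧ a s < 1) ∧ (∀ s, s ∉ S → a s = 0) ∧
      ∑ s ∈ S, a s • s ∈ latticeN κ := Iff.rfl

/-- The zero coefficient vector (the apex `0`) is always a parallelotope lattice point.
[cite: Fulton1993Toric, §2.6 p. 48] -/
theorem zero_mem_parCoeffs (S : Finset (κ → ℚ)) : (0 : (κ → ℚ) → ℚ) ∈ parCoeffs S :=
  ⟨fun _ _ => ⟨le_rfl, zero_lt_one⟩, fun _ _ => rfl, by simp⟩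

/-- Parallelotope points of a sub-family are parallelotope points of the family (coefficients
extended by `0`). [cite: Fulton1993Toric, §2.6 p. 48] -/
theorem parCoeffs_mono {T S : Finset (κ → ℚ)} (hTS : T ⊆ S) : parCoeffs T ⊆ parCoeffs S := by
  intro a ⟨hb, hz, hN⟩
  refine ⟨fun s hs => ?_, fun s hs => hz s fun h => hs (hTS h), ?_⟩
  · by_cases hsT : s ∈ T
    · exact hb s hsT
    · rw [hz s hsT]; exact ⟨le_rfl, zero_lt_one⟩
  · rw [← Finset.sum_subset hTS (fun s _ hsT => by rw [hz s hsT, zero_smul])]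
    exact hN

/-- The **parallelotope count** `pmult S = #parCoeffs S` (for a simplicial lattice cone with
primitive generators `S` this is Fulton's multiplicity `mult(σ) = [N_σ : Σ ℤvᵢ]`,
[Fulton1993Toric] §2.6 p. 48 — an identification we neither prove nor use).
[cite: Fulton1993Toric, §2.6 p. 48] -/
def pmult (S : Finset (κ → ℚ)) : ℕ := (parCoeffs S).ncard

/-- **Finiteness of the parallelotope lattice points** for linearly independent lattice vectors:
the combination map is injective on coefficient vectors supported in `S`, and its values are
lattice points with bounded integer coordinates. [cite: Fulton1993Toric, §2.6 p. 48] -/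
theorem parCoeffs_finite [Fintype κ] {S : Finset (κ → ℚ)}
    (hli : LinearIndepOn ℚ id (S : Set (κ → ℚ))) : (parCoeffs S).Finite := by
  classical
  -- bounded box of lattice points
  let B : κ → ℕ := fun i => ⌈∑ s ∈ S, |s i|⌉₊
  let box : Set (κ → ℚ) := Set.range fun g : ((i : κ) → Set.Icc (-(B i : ℤ)) (B i)) =>
    fun i => ((g i : ℤ) : ℚ)
  have hbox : box.Finite := Set.finite_range _
  refine Set.Finite.of_finite_image (hbox.subset ?_) ?_ (f := fun a => ∑ s ∈ S, a s • s)
  · rintro x ⟨a, ⟨hb, -, hN⟩, rfl⟩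
    have hcoord : ∀ i, ∃ m : ℤ, (∑ s ∈ S, a s • s) i = m ∧ |(m : ℚ)| ≤ B i := by
      intro i
      obtain ⟨m, hm⟩ := hN i
      refine ⟨m, hm, ?_⟩
      rw [← hm, Finset.sum_apply]
      calc |∑ s ∈ S, (a s • s) i| ≤ ∑ s ∈ S, |(a s • s) i| := Finset.abs_sum_le_sum_abs _ _
        _ ≤ ∑ s ∈ S, |s i| := by
            refine Finset.sum_le_sum fun s hs => ?_
            rw [Pi.smul_apply, smul_eq_mul, abs_mul]
            have h1 : |a s| ≤ 1 := by
              rw [abs_of_nonneg (hb s hs).1]; exact (hb s hs).2.le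
            calc |a s| * |s i| ≤ 1 * |s i| :=
                  mul_le_mul_of_nonneg_right h1 (abs_nonneg _)
              _ = |s i| := one_mul _
        _ ≤ B i := Nat.le_ceil _
    choose m hm hmB using hcoord
    refine ⟨fun i => ⟨m i, ?_⟩, funext fun i => (hm i).symm⟩
    have h := hmB i
    rw [← Int.cast_abs] at h
    have h' : |m i| ≤ (B i : ℤ) := by exact_mod_cast h
    exact ⟨by linarith [abs_le.mp h'], (abs_le.mp h').2⟩
  · intro a ha a' ha' h
    funext s
    by_cases hs : s ∈ S
    · exact eq_on_of_sum_smul_eq hli h s hs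
    · rw [ha.2.1 s hs, ha'.2.1 s hs]

/-- The count is positive (the apex is a parallelotope point). [cite: Fulton1993Toric, §2.6 p. 48] -/
theorem pmult_pos [Fintype κ] {S : Finset (κ → ℚ)}
    (hli : LinearIndepOn ℚ id (S : Set (κ → ℚ))) : 0 < pmult S :=
  (Set.ncard_pos (parCoeffs_finite hli)).mpr ⟨0, zero_mem_parCoeffs S⟩

/-- Monotonicity of the count in the generating family. [cite: Fulton1993Toric, §2.6 p. 48] -/
theorem pmult_mono [Fintype κ] {T S : Finset (κ → ℚ)} (hTS : T ⊆ S)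
    (hli : LinearIndepOn ℚ id (S : Set (κ → ℚ))) : pmult T ≤ pmult S :=
  Set.ncard_le_ncard (parCoeffs_mono hTS) (parCoeffs_finite hli)

/-! ## Regular (unimodular) generating sets -/

/-- `S` is a **regular** (nonsingular, unimodular) set of generators: linearly independent
lattice vectors whose `ℤ`-span is saturated in the lattice — equivalently, part of a `ℤ`-basis
of `N` ([Fulton1993Toric] §2.1 p. 29: "we call a cone nonsingular if it is generated by part of
a basis for the lattice"; [Ewald1996] V Def. 1.? "regular"). The cone they span is then a regular
cone. [cite: Fulton1993Toric, §2.1 p. 29] -/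
def IsRegularGens (S : Finset (κ → ℚ)) : Prop :=
  (∀ s ∈ S, s ∈ latticeN κ) ∧ LinearIndepOn ℚ id (S : Set (κ → ℚ)) ∧
    ∀ x ∈ latticeN κ, x ∈ Submodule.span ℚ (S : Set (κ → ℚ)) →
      x ∈ Submodule.span ℤ (S : Set (κ → ℚ))

/-- A combination `Σ_{s∈S} a_s s` lies in the `ℚ`-span of `S`. [cite: Fulton1993Toric, §1.2 p. 9] -/
theorem sum_smul_mem_span (S : Finset (κ → ℚ)) (a : (κ → ℚ) → ℚ) :
    ∑ s ∈ S, a s • s ∈ Submodule.span ℚ (S : Set (κ → ℚ)) :=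
  Submodule.sum_mem _ fun _ hs => Submodule.smul_mem _ _ (Submodule.subset_span hs)

/-- **Regular ⇔ the apex is the only lattice point of the fundamental parallelotope**
([Fulton1993Toric] §2.6 p. 48: "`U_σ` is nonsingular precisely when the multiplicity of `σ` is
one"; here in the parallelotope form), for linearly independent lattice vectors.
[cite: Fulton1993Toric, §2.6 p. 48] -/
theorem isRegularGens_iff_parCoeffs {S : Finset (κ → ℚ)} (hSN : ∀ s ∈ S, s ∈ latticeN κ)
    (hli : LinearIndepOn ℚ id (S : Set (κ → ℚ))) :
    IsRegularGens S ↔ ∀ a ∈ parCoeffs S, ∀ s ∈ S, a s = 0 := by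
  classical
  constructor
  · rintro ⟨-, -, hsat⟩ a ⟨hb, -, hN⟩ s hs
    have hxZ := hsat _ hN (sum_smul_mem_span S a)
    obtain ⟨f, -, hf⟩ := Submodule.mem_span_finset.mp hxZ
    -- compare the two expansions
    have hf' : ∑ t ∈ S, ((f t : ℤ) : ℚ) • t = ∑ t ∈ S, a t • t := by
      rw [← hf]
      refine Finset.sum_congr rfl fun t _ => ?_
      rw [Int.cast_smul_eq_zsmul]
    have hfa := eq_on_of_sum_smul_eq hli hf' s hs
    -- `a s = f s ∈ ℤ` with `0 ≤ a s < 1`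
    obtain ⟨h0, h1⟩ := hb s hs
    rw [← hfa] at h0 h1 ⊢
    have h0' : (0 : ℤ) ≤ f s := by exact_mod_cast h0
    have h1' : f s < 1 := by exact_mod_cast h1
    have : f s = 0 := by omega
    rw [this, Int.cast_zero]
  · intro h
    refine ⟨hSN, hli, fun x hxN hxQ => ?_⟩
    obtain ⟨c, -, hc⟩ := Submodule.mem_span_finset.mp hxQ
    let a : (κ → ℚ) → ℚ := fun s => if s ∈ S then Int.fract (c s) else 0
    have hsum : ∑ s ∈ S, a s • s = x - ∑ s ∈ S, ((⌊c s⌋ : ℤ) : ℚ) • s := by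
      rw [← hc, ← Finset.sum_sub_distrib]
      refine Finset.sum_congr rfl fun s hs => ?_
      simp only [a, if_pos hs, Int.fract, sub_smul]
    have ha : a ∈ parCoeffs S := by
      refine ⟨fun s hs => ?_, fun s hs => if_neg hs, ?_⟩
      · simp only [a, if_pos hs]; exact ⟨Int.fract_nonneg _, Int.fract_lt_one _⟩
      · rw [hsum]
        exact Submodule.sub_mem _ hxN (sum_intCast_smul_mem_latticeN hSN _)
    have hzero : ∑ s ∈ S, a s • s = 0 :=
      Finset.sum_eq_zero fun s hs => by rw [h a ha s hs, zero_smul]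
    have hx : x = ∑ s ∈ S, ((⌊c s⌋ : ℤ) : ℚ) • s := by
      rw [hzero] at hsum; exact (sub_eq_zero.mp hsum.symm)
    rw [hx]
    refine Submodule.sum_mem _ fun s hs => ?_
    rw [Int.cast_smul_eq_zsmul]
    exact Submodule.smul_mem _ _ (Submodule.subset_span hs)

/-- **If `S` is not regular, its parallelotope contains a nonzero lattice point**
`w = Σ a_s s`, `0 ≤ a_s < 1`, some `a_j ≠ 0` ([Fulton1993Toric] §2.6 p. 48, Exercise:
"if `mult(σ) > 1` there is a lattice point of the form `v = Σ tᵢvᵢ`, `0 ≤ tᵢ < 1`").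
[cite: Fulton1993Toric, §2.6 p. 48] -/
theorem exists_ne_zero_of_not_isRegularGens {S : Finset (κ → ℚ)} (hSN : ∀ s ∈ S, s ∈ latticeN κ)
    (hli : LinearIndepOn ℚ id (S : Set (κ → ℚ))) (h : ¬ IsRegularGens S) :
    ∃ a ∈ parCoeffs S, ∃ j ∈ S, a j ≠ 0 := by
  rw [isRegularGens_iff_parCoeffs hSN hli] at h
  push Not at h
  exact h

/-- A regular set of generators has parallelotope count `1`. [cite: Fulton1993Toric, §2.6 p. 48] -/
theorem pmult_eq_one_of_isRegularGens [Fintype κ] {S : Finset (κ → ℚ)} (h : IsRegularGens S) :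
    pmult S = 1 := by
  rw [pmult, Set.ncard_eq_one]
  refine ⟨0, Set.eq_singleton_iff_unique_mem.mpr ⟨zero_mem_parCoeffs S, fun a ha => ?_⟩⟩
  funext s
  by_cases hs : s ∈ S
  · exact (isRegularGens_iff_parCoeffs h.1 h.2.1).mp h a ha s hs
  · exact ha.2.1 s hs

/-- Parallelotope count `1` means regular (for linearly independent lattice vectors).
[cite: Fulton1993Toric, §2.6 p. 48] -/
theorem isRegularGens_of_pmult_eq_one [Fintype κ] {S : Finset (κ → ℚ)}
    (hSN : ∀ s ∈ S, s ∈ latticeN κ) (hli : LinearIndepOn ℚ id (S : Set (κ → ℚ)))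
    (h : pmult S = 1) : IsRegularGens S := by
  rw [isRegularGens_iff_parCoeffs hSN hli]
  intro a ha s hs
  obtain ⟨a₀, ha₀⟩ := Set.ncard_eq_one.mp h
  have h1 : a = a₀ := by rw [ha₀] at ha; exact ha
  have h2 : (0 : (κ → ℚ) → ℚ) = a₀ := by
    have := zero_mem_parCoeffs S; rw [ha₀] at this; exact this
  rw [h1, ← h2]; rfl

/-! ## The count drops under a star subdivision (exchange of a generator) -/

/-- A nonzero parallelotope coefficient vector gives a nonzero lattice point `w = Σ a_s s`
which is not one of the generators. [cite: Fulton1993Toric, §2.6 p. 48] -/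
theorem sum_smul_notMem_of_parCoeffs {S : Finset (κ → ℚ)}
    (hli : LinearIndepOn ℚ id (S : Set (κ → ℚ))) {a : (κ → ℚ) → ℚ} (ha : a ∈ parCoeffs S) :
    ∑ s ∈ S, a s • s ∉ S := by
  classical
  intro hw
  set w := ∑ s ∈ S, a s • s with hwdef
  have hind : ∑ s ∈ S, (if s = w then (1 : ℚ) else 0) • s = w := by
    simp only [ite_smul, one_smul, zero_smul, Finset.sum_ite_eq', if_pos hw]
  have hrepr : ∑ s ∈ S, a s • s = ∑ s ∈ S, (if s = w then (1 : ℚ) else 0) • s := by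
    rw [hind]
  have h1 := eq_on_of_sum_smul_eq hli hrepr w hw
  simp only [if_true] at h1
  exact absurd h1 (ha.1 w hw).2.ne

/-- **The parallelotope count drops under the exchange of a generator by a parallelotope
lattice point** ([Fulton1993Toric] §2.6 p. 48, Exercise: for `v = Σ tᵢ vᵢ` "the multiplicities
of the subdivided cones are `tᵢ · mult(σ)`" — we prove `pmult((S ∖ {v_j}) ∪ {w}) < pmult S`
for `t_j ≠ 0`): reducing coefficients mod `1` injects the parallelotope points of the new
cone into those of `S`, and the point `w` itself is missed. [cite: Fulton1993Toric, §2.6 p. 48] -/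
theorem pmult_exchange_lt [Fintype κ] [DecidableEq (κ → ℚ)] {S : Finset (κ → ℚ)}
    (hSN : ∀ s ∈ S, s ∈ latticeN κ) (hli : LinearIndepOn ℚ id (S : Set (κ → ℚ)))
    {a : (κ → ℚ) → ℚ} (ha : a ∈ parCoeffs S) {j : κ → ℚ} (hj : j ∈ S) (haj : a j ≠ 0) :
    pmult (insert (∑ s ∈ S, a s • s) (S.erase j)) < pmult S := by
  set w := ∑ s ∈ S, a s • s with hwdef
  obtain ⟨hb, hz, hwN⟩ := ha
  have hwS : w ∉ S := sum_smul_notMem_of_parCoeffs hli ⟨hb, hz, hwN⟩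
  have hwSj : w ∉ S.erase j := fun h => hwS (Finset.mem_of_mem_erase h)
  have hjw : j ≠ w := fun h => hwS (h ▸ hj)
  have hajpos : 0 < a j := lt_of_le_of_ne (hb j hj).1 (Ne.symm haj)
  -- the injection "reduce mod 1"
  let F : ((κ → ℚ) → ℚ) → ((κ → ℚ) → ℚ) := fun b s =>
    if s = j then b w * a j else if s ∈ S then Int.fract (b s + b w * a s) else 0
  have hFin : (parCoeffs S).Finite := parCoeffs_finite hli
  -- (1) `F` maps the new parallelotope points into the old ones, missing `a`
  have hmaps : ∀ b ∈ parCoeffs (insert w (S.erase j)), F b ∈ parCoeffs S \ {a} := by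
    intro b hbmem
    obtain ⟨hbb, hbz, hbN⟩ := hbmem
    have hbw : 0 ≤ b w ∧ b w < 1 := hbb w (Finset.mem_insert_self _ _)
    refine ⟨⟨fun s hs => ?_, fun s hs => ?_, ?_⟩, ?_⟩
    · by_cases hsj : s = j
      · subst hsj
        simp only [F, if_true]
        exact ⟨mul_nonneg hbw.1 (hb s hj).1,
          by nlinarith [hbw.2, (hb s hj).2, hbw.1, (hb s hj).1]⟩
      · simp only [F, if_neg hsj, if_pos hs]
        exact ⟨Int.fract_nonneg _, Int.fract_lt_one _⟩
    · have hsj : s ≠ j := fun h => hs (h ▸ hj)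
      simp only [F, if_neg hsj, if_neg hs]
    · -- the lattice condition: `Σ F(b)_s s = (Σ_{new} b_s s) - Σ_{s≠j} ⌊…⌋ s`
      have hbj : b j = 0 := hbz j (by simp [hjw])
      have hsum : ∑ s ∈ S, F b s • s =
          ∑ s ∈ insert w (S.erase j), b s • s -
            ∑ s ∈ S.erase j, ((⌊b s + b w * a s⌋ : ℤ) : ℚ) • s := by
        rw [Finset.sum_insert hwSj, ← Finset.add_sum_erase S _ hj, hwdef, Finset.smul_sum,
          ← Finset.add_sum_erase S (fun s => b (∑ s ∈ S, a s • s) • a s • s) hj]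
        simp only [F, if_true]
        rw [← hwdef]
        have hrest : ∑ s ∈ S.erase j, F b s • s =
            ∑ s ∈ S.erase j, (b s • s + b w • a s • s - ((⌊b s + b w * a s⌋ : ℤ) : ℚ) • s) := by
          refine Finset.sum_congr rfl fun s hs => ?_
          have hsj : s ≠ j := Finset.ne_of_mem_erase hs
          have hsS : s ∈ S := Finset.mem_of_mem_erase hs
          simp only [F, if_neg hsj, if_pos hsS, Int.fract]
          rw [sub_smul, add_smul, smul_smul]
        rw [hrest, Finset.sum_sub_distrib, Finset.sum_add_distrib, smul_smul]
        abel
      rw [hsum]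
      exact Submodule.sub_mem _ hbN
        (sum_intCast_smul_mem_latticeN (fun s hs => hSN s (Finset.mem_of_mem_erase hs)) _)
    · -- `F b ≠ a`: the `j`-coordinate would force `b w = 1`
      intro hFa
      have h1 : F b j = a j := by rw [Set.mem_singleton_iff.mp hFa]
      simp only [F, if_true] at h1
      have : b w = 1 := by
        have := mul_right_cancel₀ haj (h1.trans (one_mul (a j)).symm)
        exact this
      exact absurd this hbw.2.ne
  -- (2) `F` is injective on the new parallelotope points
  have hinj : Set.InjOn F (parCoeffs (insert w (S.erase j))) := by
    intro b hbm b' hbm' hFF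
    obtain ⟨hbb, hbz, -⟩ := hbm
    obtain ⟨hbb', hbz', -⟩ := hbm'
    have hjF : F b j = F b' j := by rw [hFF]
    simp only [F, if_true] at hjF
    have hww : b w = b' w := mul_right_cancel₀ haj hjF
    funext s
    by_cases hsw : s = w
    · rw [hsw]; exact hww
    by_cases hs : s ∈ S.erase j
    · have hsj : s ≠ j := Finset.ne_of_mem_erase hs
      have hsS : s ∈ S := Finset.mem_of_mem_erase hs
      have hsF : F b s = F b' s := by rw [hFF]
      simp only [F, if_neg hsj, if_pos hsS, ← hww] at hsF
      obtain ⟨z, hzeq⟩ := Int.fract_eq_fract.mp hsF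
      have hzs : b s - b' s = z := by linarith
      have hs1 := hbb s (Finset.mem_insert_of_mem hs)
      have hs2 := hbb' s (Finset.mem_insert_of_mem hs)
      have hz1 : ((z : ℤ) : ℚ) < 1 := by rw [← hzs]; linarith [hs1.2, hs2.1]
      have hz2 : (-1 : ℚ) < z := by rw [← hzs]; linarith [hs1.1, hs2.2]
      have hz1' : z < 1 := by exact_mod_cast hz1
      have hz2' : -1 < z := by exact_mod_cast hz2
      have hz0 : z = 0 := by omega
      rw [hz0, Int.cast_zero, sub_eq_zero] at hzs
      exact hzs
    · have hs' : s ∉ insert w (S.erase j) := by simp [hsw, hs]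
      rw [hbz s hs', hbz' s hs']
  -- (3) count
  have hle : pmult (insert w (S.erase j)) ≤ (parCoeffs S \ {a}).ncard :=
    Set.ncard_le_ncard_of_injOn F hmaps hinj hFin.sdiff
  have hlt : (parCoeffs S \ {a}).ncard < pmult S := by
    rw [pmult, ← Set.ncard_sdiff_singleton_add_one (show a ∈ parCoeffs S from ⟨hb, hz, hwN⟩) hFin]
    exact Nat.lt_succ_self _
  exact hle.trans_lt hlt

end Literature.Geometry.PolyhedralFans

end
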